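import Summits.MatrixMultiplication.MatrixMultiplication.Theorems.FarEdgeDescentSpecialLevel
import HarnessLib

/-!
# Far-edge descent, Kernel XI-d — the gauge points are flat on the line and on corank `≤ 1`

Support for `Summit.MatrixMultiplication.MatrixMultiplication.Theses.FarEdgeDescent`
(aside `SubLogRate`; lens «structural dichotomy (special vs generic)», generation 36).

The three GAUGE POINTS `ζ⁽¹⁾, ζ⁽²⁾, ζ⁽³⁾` of the asymptotic spectrum (flattening ranks; CVZ
Example 1.4, Strassen 1988 (3.10)) are the classical lower-bound functionals for `R̃`.  This
file shows they are BLIND to the lens dichotomy on the support class of `⟨2,2,2⟩`: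

* (§1) `ζ⁽ⁱ⁾(𝔖(q)) = 4` for `i = 1, 2, 3`, every `q`, every field (the four slices in each
  direction have disjoint supports and a weight-`1` pivot each) — X-c had `ζ⁽¹⁾`;
* (§2) hence, by the corank stratification XI-c, **`ζ⁽ⁱ⁾(T) = 4` for every `T ∈ V_S` of
  corank `≤ 1`** (generic members and the whole corank-one special stratum), every field;
* (§3) so the two numbers of the lens, `r_gen = R̃(𝔖(q₀)) ∈ [2^ω, 2^ω + 1]` and the special
  value `s = R̃(𝔖(0)) ∈ [max(4, 2^ω − 1), 6]`, are INVISIBLE to the gauge points beyond the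
  floor `4`: any universal spectral point realising `R̃(T) > 4` at a corank-`≤ 1` member (which
  exists by Strassen duality as soon as `R̃(T) > 4`) is none of `ζ⁽¹⁾, ζ⁽²⁾, ζ⁽³⁾`
  (`exists_nonGauge_of_four_lt`).  In particular `ω > 2 ⟹ r_gen > 4 ⟹` the asymptotic
  spectrum of `4 × 4 × 4` tensors over `ℂ` has a non-gauge point exceeding `4` on the BCZ line
  (`exists_nonGauge_on_line_of_not_summit`) — the typed form of this lens's BARRIER tag
  (flattening-type lower bounds cannot certify the failure window `r_gen ∈ (4, 5]`).

## References

* M. Christandl, P. Vrana, J. Zuiddam, *Universal points in the asymptotic spectrum of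
  tensors*, J. Amer. Math. Soc. 36 (2023), Example 1.4. [ChristandlVranaZuiddam2023]
* V. Strassen, *The asymptotic spectrum of tensors*, J. reine angew. Math. 384 (1988), (3.10),
  Thm. 3.9. [Strassen1988]
* M. Bläser, M. Christandl, J. Zuiddam, arXiv:1705.09652 (2017), Lemma 3.
  [BlaserChristandlZuiddam2017]
-/

noncomputable section

open scoped BigOperators

set_option linter.dupNamespace false

namespace Summit.MatrixMultiplication.MatrixMultiplication.Theorems.FarEdgeDescentGaugeFlat

open Literature.Computability.AlgebraicComplexity
open Summit.MatrixMultiplication.MatrixMultiplication.Theorems.FarEdgeDescentSignTwist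
open Summit.MatrixMultiplication.MatrixMultiplication.Theorems.FarEdgeDescentSignTwistDet
open Summit.MatrixMultiplication.MatrixMultiplication.Theorems.FarEdgeDescentWeightFamily
open Summit.MatrixMultiplication.MatrixMultiplication.Theorems.FarEdgeDescentGenericDomination
open Summit.MatrixMultiplication.MatrixMultiplication.Theorems.FarEdgeDescentSupportStratumDoor
open Summit.MatrixMultiplication.MatrixMultiplication.Theorems.FarEdgeDescentRankOneCoupling
open Summit.MatrixMultiplication.MatrixMultiplication.Theorems.FarEdgeDescentZeroWeightMember
open Summit.MatrixMultiplication.MatrixMultiplication.Theorems.FarEdgeDescentSupportClass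
open Summit.MatrixMultiplication.MatrixMultiplication.Theorems.FarEdgeDescentSpecialClass
open Summit.MatrixMultiplication.MatrixMultiplication.Theorems.FarEdgeDescentSpecialValue
open Summit.MatrixMultiplication.MatrixMultiplication.Theorems.FarEdgeDescentSpecialLevel

/-! ## §1 All three gauge points are `4` along the whole line (every field) -/

section AnyField

variable {K : Type} [Field K]

/-- The `y`-slices (middle index) of `𝔖(q)` are linearly independent: slice `(i,k)` is the only
one supported at `(inl (i,0), inl (k,0))`, an entry of weight `1`.
[cite: BurgisserClausenShokrollahi1997, (14.8)] -/
theorem linearIndependent_ySlices_fam (q : K) :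
    LinearIndependent K (fun b : Fin 2 × Fin 2 => fun p : Leaf2 × Leaf2 => fam K q p.1 b p.2) := by
  rw [Fintype.linearIndependent_iff]
  intro g hg
  have key : ∀ p : Leaf2 × Leaf2, ∑ b, g b * fam K q p.1 b p.2 = 0 := fun p => by
    have h := congrFun hg p
    simpa [Finset.sum_apply, Pi.smul_apply, smul_eq_mul] using h
  have e₁ := key (Sum.inl ((0 : Fin 2), (0 : Fin 1)), Sum.inl ((0 : Fin 2), (0 : Fin 1)))
  have e₂ := key (Sum.inl ((0 : Fin 2), (0 : Fin 1)), Sum.inl ((1 : Fin 2), (0 : Fin 1)))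
  have e₃ := key (Sum.inl ((1 : Fin 2), (0 : Fin 1)), Sum.inl ((0 : Fin 2), (0 : Fin 1)))
  have e₄ := key (Sum.inl ((1 : Fin 2), (0 : Fin 1)), Sum.inl ((1 : Fin 2), (0 : Fin 1)))
  simp [Fintype.sum_prod_type, matMulTensor] at e₁ e₂ e₃ e₄
  intro b
  obtain ⟨i, k⟩ := b
  fin_cases i <;> fin_cases k <;> simp_all

/-- The `z`-slices (second leaf) of `𝔖(q)` are linearly independent: slice `inl (k,0)` is the
only one supported at `(inl (0,0), (0,k))`, slice `inr (k,0)` the only one at `(inr (0,0), (0,k))`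
(weights `1`: the `q`-entry sits at middle index `(1,0)`).
[cite: BurgisserClausenShokrollahi1997, (14.8)] -/
theorem linearIndependent_zSlices_fam (q : K) :
    LinearIndependent K
      (fun c : Leaf2 => fun p : Leaf2 × (Fin 2 × Fin 2) => fam K q p.1 p.2 c) := by
  rw [Fintype.linearIndependent_iff]
  intro g hg
  have key : ∀ p : Leaf2 × (Fin 2 × Fin 2), ∑ c, g c * fam K q p.1 p.2 c = 0 := fun p => by
    have h := congrFun hg p
    simpa [Finset.sum_apply, Pi.smul_apply, smul_eq_mul] using h
  have e₁ := key (Sum.inl ((0 : Fin 2), (0 : Fin 1)), ((0 : Fin 2), (0 : Fin 2)))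
  have e₂ := key (Sum.inl ((0 : Fin 2), (0 : Fin 1)), ((0 : Fin 2), (1 : Fin 2)))
  have e₃ := key (Sum.inr ((0 : Fin 2), (0 : Fin 1)), ((0 : Fin 2), (0 : Fin 2)))
  have e₄ := key (Sum.inr ((0 : Fin 2), (0 : Fin 1)), ((0 : Fin 2), (1 : Fin 2)))
  simp [Fintype.sum_sum_type, Fintype.sum_prod_type, matMulTensor, famW] at e₁ e₂ e₃ e₄
  intro c
  rcases c with ⟨k, l⟩ | ⟨k, l⟩ <;> fin_cases k <;> fin_cases l <;> simp_all

/-- **`ζ⁽¹⁾(𝔖(q)) = 4`** (X-c's flattening rank, as a gauge-point value).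
[cite: ChristandlVranaZuiddam2023, Example 1.4] -/
theorem gaugePoint₁_fam (q : K) : gaugePoint₁ K (fam K q) = 4 := by
  rw [gaugePoint₁_eq, flatteningRank_fam q]
  norm_num

/-- **`ζ⁽²⁾(𝔖(q)) = 4`.** [cite: ChristandlVranaZuiddam2023, Example 1.4] -/
theorem gaugePoint₂_fam (q : K) : gaugePoint₂ K (fam K q) = 4 := by
  have h := finrank_span_eq_card (linearIndependent_ySlices_fam q)
  simp only [Fintype.card_prod, Fintype.card_fin] at h
  show (Module.finrank K (Submodule.span K (Set.range fun b : Fin 2 × Fin 2 =>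
    fun p : Leaf2 × Leaf2 => fam K q p.1 b p.2)) : ℝ) = 4
  rw [h]
  norm_num

/-- **`ζ⁽³⁾(𝔖(q)) = 4`.** [cite: ChristandlVranaZuiddam2023, Example 1.4] -/
theorem gaugePoint₃_fam (q : K) : gaugePoint₃ K (fam K q) = 4 := by
  have h := finrank_span_eq_card (linearIndependent_zSlices_fam q)
  simp only [Fintype.card_sum, Fintype.card_prod, Fintype.card_fin] at h
  show (Module.finrank K (Submodule.span K (Set.range fun c : Leaf2 =>
    fun p : Leaf2 × (Fin 2 × Fin 2) => fam K q p.1 p.2 c)) : ℝ) = 4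
  rw [h]
  norm_num

/-- All three gauge points are `4` at every member of the line.
[cite: ChristandlVranaZuiddam2023, Example 1.4] -/
theorem gaugePoints_fam (q : K) :
    gaugePoint₁ K (fam K q) = 4 ∧ gaugePoint₂ K (fam K q) = 4 ∧ gaugePoint₃ K (fam K q) = 4 :=
  ⟨gaugePoint₁_fam q, gaugePoint₂_fam q, gaugePoint₃_fam q⟩

/-! ## §2 … and on the corank-`≤ 1` strata of the support class -/

/-- **The gauge points are flat on corank `≤ 1`**: every `T` supported inside `supp 𝔖(1)` with
at most one vanishing support entry has `ζ⁽¹⁾(T) = ζ⁽²⁾(T) = ζ⁽³⁾(T) = 4`, over every field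
(corank `0`: torus translate of `𝔖(q)`; corank `1`: the exact level set XI-c).
[cite: BlaserChristandlZuiddam2017, Lemma 3] [cite: ChristandlVranaZuiddam2023, Example 1.4] -/
theorem gaugePoints_eq_four_of_corank_le_one {T : Leaf2 → (Fin 2 × Fin 2) → Leaf2 → K}
    (hT : ∀ a x c, fam K 1 a x c = 0 → T a x c = 0) (h : (zeroEntries T).card ≤ 1) :
    gaugePoint₁ K T = 4 ∧ gaugePoint₂ K T = 4 ∧ gaugePoint₃ K T = 4 := by
  rcases Nat.lt_or_ge (zeroEntries T).card 1 with h0 | h1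
  · obtain ⟨q, -, -, hΦ⟩ := of_zeroEntries_eq_empty hT (Finset.card_eq_zero.1 (by omega))
    exact ⟨(hΦ _ (gaugePoint₁_isUniversalSpectralPoint K)).trans (gaugePoint₁_fam q),
      (hΦ _ (gaugePoint₂_isUniversalSpectralPoint K)).trans (gaugePoint₂_fam q),
      (hΦ _ (gaugePoint₃_isUniversalSpectralPoint K)).trans (gaugePoint₃_fam q)⟩
  · have hc : (zeroEntries T).card = 1 := le_antisymm h h1
    have hΦ := (of_zeroEntries_card_eq_one hT hc).2
    exact ⟨(hΦ _ (gaugePoint₁_isUniversalSpectralPoint K)).trans (gaugePoint₁_fam 0),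
      (hΦ _ (gaugePoint₂_isUniversalSpectralPoint K)).trans (gaugePoint₂_fam 0),
      (hΦ _ (gaugePoint₃_isUniversalSpectralPoint K)).trans (gaugePoint₃_fam 0)⟩

/-! ## §3 Whatever exceeds `4` on these strata is not a gauge point -/

/-- **A value `R̃(T) > 4` at a corank-`≤ 1` member is realised by a NON-GAUGE point of the
asymptotic spectrum** (Strassen duality gives a realising point; §2 excludes the gauge points).
[cite: Strassen1988, Thm. 3.9] [cite: ChristandlVranaZuiddam2023, Example 1.4] -/
theorem exists_nonGauge_of_four_lt {T : Leaf2 → (Fin 2 × Fin 2) → Leaf2 → K}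
    (hT : ∀ a x c, fam K 1 a x c = 0 → T a x c = 0) (h : (zeroEntries T).card ≤ 1)
    (h4 : 4 < asymptoticRank T) :
    ∃ Φ : SpectralMap K, IsUniversalSpectralPoint K Φ ∧ Φ T = asymptoticRank T ∧ 4 < Φ T ∧
      Φ ≠ gaugePoint₁ K ∧ Φ ≠ gaugePoint₂ K ∧ Φ ≠ gaugePoint₃ K := by
  obtain ⟨Φ, hΦ, hΦT⟩ := (strassen_duality_asymptoticRank_holds K T).2
  obtain ⟨h₁, h₂, h₃⟩ := gaugePoints_eq_four_of_corank_le_one hT h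
  refine ⟨Φ, hΦ, hΦT, hΦT ▸ h4, ?_, ?_, ?_⟩ <;> rintro rfl <;> linarith

/-- **On the line**: `R̃(𝔖(q)) > 4` is witnessed by a non-gauge point (`𝔖(q)` has corank `0`
for `q ≠ 0` and corank `1` for `q = 0`; here directly from §1).
[cite: Strassen1988, Thm. 3.9] [cite: ChristandlVranaZuiddam2023, Example 1.4] -/
theorem exists_nonGauge_fam_of_four_lt (q : K) (h4 : 4 < asymptoticRank (fam K q)) :
    ∃ Φ : SpectralMap K, IsUniversalSpectralPoint K Φ ∧ Φ (fam K q) = asymptoticRank (fam K q) ∧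
      4 < Φ (fam K q) ∧ Φ ≠ gaugePoint₁ K ∧ Φ ≠ gaugePoint₂ K ∧ Φ ≠ gaugePoint₃ K := by
  obtain ⟨Φ, hΦ, hΦT⟩ := (strassen_duality_asymptoticRank_holds K (fam K q)).2
  obtain ⟨h₁, h₂, h₃⟩ := gaugePoints_fam q
  refine ⟨Φ, hΦ, hΦT, hΦT ▸ h4, ?_, ?_, ?_⟩ <;> rintro rfl <;> linarith

end AnyField

/-! ## §4 Over `ℂ`: the failure window of the lens is gauge-invisible -/

section Complex

/-- **`ω > 2 ⟹` a non-gauge point `> 4` on the BCZ line.**  If the summit fails then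
`r_gen = R̃(𝔖(q₀)) ≥ 2^ω > 4` (X-a window at a dominant member, which exists), and the point
realising it is none of the three gauge points — the lens's failure window `r_gen ∈ (4, 5]`
(under `ω = 2`: `summit_dichotomy`) resp. `r_gen > 4` (under `ω > 2`) is invisible to
flattening-rank lower bounds. [conditional: MatrixMultiplication (negated hypothesis)]
[cite: Strassen1988, Thm. 3.9] [cite: ChristandlVranaZuiddam2023, Example 1.4] -/
theorem exists_nonGauge_on_line_of_not_summit (hS : ¬ _root_.MatrixMultiplication) :
    ∃ (q₀ : ℂ) (Φ : SpectralMap ℂ), IsUniversalSpectralPoint ℂ Φ ∧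
      (∀ q, asymptoticRank (fam ℂ q) ≤ asymptoticRank (fam ℂ q₀)) ∧
        Φ (fam ℂ q₀) = asymptoticRank (fam ℂ q₀) ∧ 4 < Φ (fam ℂ q₀) ∧
          Φ ≠ gaugePoint₁ ℂ ∧ Φ ≠ gaugePoint₂ ℂ ∧ Φ ≠ gaugePoint₃ ℂ := by
  obtain ⟨q₀, hq₀⟩ := exists_dominant_fam
  have h4 : 4 < asymptoticRank (fam ℂ q₀) := by
    by_contra hle
    exact hS (summit_of_asymptoticRank_fam_le_four one_ne_zero ((hq₀ 1).trans (not_lt.1 hle)))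
  obtain ⟨Φ, hΦ, hΦT, hlt, h₁, h₂, h₃⟩ := exists_nonGauge_fam_of_four_lt q₀ h4
  exact ⟨q₀, Φ, hΦ, hq₀, hΦT, hlt, h₁, h₂, h₃⟩

/-- **Equivalently**: if every universal spectral point exceeding `4` somewhere on the line is
a gauge point — i.e. nothing but flattening ranks ever certifies `> 4` there — then `ω = 2`.
[cite: Strassen1988, Thm. 3.9] [cite: ChristandlVranaZuiddam2023, Example 1.4] -/
theorem summit_of_only_gauge_exceeds_four
    (h : ∀ Φ : SpectralMap ℂ, IsUniversalSpectralPoint ℂ Φ → ∀ q : ℂ, 4 < Φ (fam ℂ q) →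
      Φ = gaugePoint₁ ℂ ∨ Φ = gaugePoint₂ ℂ ∨ Φ = gaugePoint₃ ℂ) :
    _root_.MatrixMultiplication := by
  by_contra hS
  obtain ⟨q₀, Φ, hΦ, -, -, hlt, h₁, h₂, h₃⟩ := exists_nonGauge_on_line_of_not_summit hS
  rcases h Φ hΦ q₀ hlt with e | e | e
  · exact h₁ e
  · exact h₂ e
  · exact h₃ e

end Complex

end Summit.MatrixMultiplication.MatrixMultiplication.Theorems.FarEdgeDescentGaugeFlat

end
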